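import Literature.Computability.AlgebraicComplexity.SyndromePolynomial
import HarnessLib

/-!
# ValiantsHypothesis / RyserTripartition — block sums for `PerLeTripartition`: the row-DP recursion and the three-row-block expansion in injection currency

Support file (theorem-only, no definitions) for item `stmt-ValiantsHypothesis-11286`
(`PerLeTripartition`) of route `ValiantsHypothesis/RyserTripartition`: the ALGEBRA of the bridge
"`per_{3k}` is Pratt's tripartition form `T_k` evaluated at three tables of `k × k`
sub-permanents" (K. Pratt, arXiv:2311.02774, §1; the route thesis), in the INJECTION CURRENCY
that the syntactically multilinear row-DP circuit computes (partial tables over the first `j` rows of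
a block, indexed by maps `Fin j → Fin (3k)`). Companion of `RyserTripartitionPerLeTripartitionLaplace.lean` (bijection currency, via Minc);
here the currency in which the DP recursion `blockTable_succ` holds verbatim.

Rows of the `3k × 3k` matrix are split into the three blocks `b ∈ Fin 3` through
`finProdFinEquiv : Fin 3 × Fin k ≃ Fin (3k)` (row `(b, t)`); the tree's generic permanent is
`perPoly (Fin n) R = ∑_{j bijective} ∏_i X (i, j i)` (one variable per ROW,
`perPoly_eq_sum_filter_bijective`). For a row block `b`, a number `j ≤ k` of its first rows and a set
`S` of columns, the PARTIAL BLOCK PERMANENT is written inline (no definition) as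
`∑ f : Fin j → Fin (3k), [f injective ∧ im f = S] ∏_{t<j} X ((b, t), f t)`.

* `blockTable_succ` — the row-DP recursion (expansion of the partial block permanent along its last
  row): `P_b^{j+1}(S) = ∑_{r ∈ S} P_b^{j}(S ∖ {r}) · X ((b, j), r)`; this is what the syntactically
  multilinear DP circuit of the bridge implements, one product per `(S, r)`.
* `aeval_tripartition_eq_perPoly` — the 3-block Laplace expansion in the form the item needs:
  substituting `X (b, S) ↦ P_b^{k}(S)` into
  `T_k = ∑_{S,T,U} [S,T,U pairwise disjoint] X(0,S) X(1,T) X(2,U)` gives `perPoly (Fin (3k))`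
  (a bijective row-to-column map = three injective block maps with pairwise disjoint images).

HONEST FRAMING: elementary bookkeeping for a dormant route; nothing here bears on `VP ≠ VNP`.
-/

-- layout Summits/ValiantsHypothesis/ValiantsHypothesis forces the duplicated namespace component
set_option linter.dupNamespace false

namespace Summit.ValiantsHypothesis.ValiantsHypothesis.Theorems.RyserTripartition

open MvPolynomial Literature.Computability.AlgebraicComplexity Finset

universe u

variable {R : Type u} [CommSemiring R]

/-! ### `Fin.snoc` bookkeeping -/

/-- `Fin.snoc g x` is injective iff `g` is injective and `x` is a new value. [folklore] -/
theorem snoc_injective_iff {β : Type*} {j : ℕ} (g : Fin j → β) (x : β) :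
    Function.Injective (Fin.snoc g x : Fin (j + 1) → β) ↔
      Function.Injective g ∧ x ∉ Set.range g := by
  constructor
  · intro h
    refine ⟨fun t t' htt' => ?_, ?_⟩
    · have := @h (Fin.castSucc t) (Fin.castSucc t') (by simpa [Fin.snoc_castSucc] using htt')
      exact Fin.castSucc_injective _ this
    · rintro ⟨t, ht⟩
      have := @h (Fin.castSucc t) (Fin.last j) (by simp [Fin.snoc_castSucc, Fin.snoc_last, ht])
      exact (Fin.castSucc_lt_last t).ne this
  · rintro ⟨hg, hx⟩ t t' htt'
    induction t using Fin.lastCases with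
    | last =>
      induction t' using Fin.lastCases with
      | last => rfl
      | cast t' =>
        exfalso
        simp only [Fin.snoc_last, Fin.snoc_castSucc] at htt'
        exact hx ⟨t', htt'.symm⟩
    | cast t =>
      induction t' using Fin.lastCases with
      | last =>
        exfalso
        simp only [Fin.snoc_last, Fin.snoc_castSucc] at htt'
        exact hx ⟨t, htt'⟩
      | cast t' =>
        simp only [Fin.snoc_castSucc] at htt'
        rw [hg htt']

/-- The image of `Fin.snoc g x` is `insert x (image g)`. [folklore] -/
theorem image_univ_snoc {β : Type*} [DecidableEq β] {j : ℕ} (g : Fin j → β) (x : β) :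
    Finset.univ.image (Fin.snoc g x : Fin (j + 1) → β) = insert x (Finset.univ.image g) := by
  ext y
  simp only [Finset.mem_image, Finset.mem_univ, true_and, Finset.mem_insert]
  constructor
  · rintro ⟨t, rfl⟩
    induction t using Fin.lastCases with
    | last => exact Or.inl (by simp [Fin.snoc_last])
    | cast t => exact Or.inr ⟨t, by simp [Fin.snoc_castSucc]⟩
  · rintro (rfl | ⟨t, rfl⟩)
    · exact ⟨Fin.last j, by simp [Fin.snoc_last]⟩
    · exact ⟨Fin.castSucc t, by simp [Fin.snoc_castSucc]⟩

/-! ### The row-DP recursion -/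

/-- **Row-DP recursion for partial block permanents.** For a row block `b`, `j + 1 ≤ k` rows and a
column set `S`: `P_b^{j+1}(S) = ∑_{r ∈ S} P_b^{j}(S ∖ {r}) · X ((b, j), r)` (expansion along the last
of the `j + 1` rows; the maps `f : Fin (j+1) → Fin (3k)` with image `S` are the pairs
`(f ∘ castSucc, f (last))`). [folklore] -/
theorem blockTable_succ (k : ℕ) (b : Fin 3) {j : ℕ} (hj : j + 1 ≤ k) (S : Finset (Fin (3 * k))) :
    (∑ f : Fin (j + 1) → Fin (3 * k),
      (if Function.Injective f ∧ Finset.univ.image f = S then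
        ∏ t : Fin (j + 1),
          (X (finProdFinEquiv (b, Fin.castLE hj t), f t) : MvPolynomial (Fin (3 * k) × Fin (3 * k)) R)
       else 0)) =
    ∑ r ∈ S, (∑ g : Fin j → Fin (3 * k),
      (if Function.Injective g ∧ Finset.univ.image g = S.erase r then
        ∏ t : Fin j,
          (X (finProdFinEquiv (b, Fin.castLE ((Nat.le_succ j).trans hj) t), g t) :
            MvPolynomial (Fin (3 * k) × Fin (3 * k)) R)
       else 0)) * X (finProdFinEquiv (b, ⟨j, hj⟩), r) := by
  classical
  -- split `f = Fin.snoc g x`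
  rw [← Fintype.sum_equiv (Fin.snocEquiv fun _ : Fin (j + 1) => Fin (3 * k))
    (fun p => if Function.Injective (Fin.snoc p.2 p.1 : Fin (j + 1) → Fin (3 * k)) ∧
        Finset.univ.image (Fin.snoc p.2 p.1 : Fin (j + 1) → Fin (3 * k)) = S then
        ∏ t : Fin (j + 1),
          (X (finProdFinEquiv (b, Fin.castLE hj t), (Fin.snoc p.2 p.1 : Fin (j + 1) → Fin (3 * k)) t) :
            MvPolynomial (Fin (3 * k) × Fin (3 * k)) R)
       else 0) _ (fun _ => rfl)]
  rw [Fintype.sum_prod_type]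
  -- the right-hand side as a sum over all `r` with the indicator of `r ∈ S`
  have hrhs : ∀ (H : Fin (3 * k) → MvPolynomial (Fin (3 * k) × Fin (3 * k)) R),
      ∑ r ∈ S, H r = ∑ r, if r ∈ S then H r else 0 := by
    intro H
    rw [← Finset.sum_filter, Finset.filter_mem_eq_inter, Finset.univ_inter]
  rw [hrhs]
  refine Finset.sum_congr rfl fun x _ => ?_
  -- the product over `Fin (j+1)` splits off its last factor
  have hprod : ∀ g : Fin j → Fin (3 * k),
      (∏ t : Fin (j + 1),
          (X (finProdFinEquiv (b, Fin.castLE hj t), (Fin.snoc g x : Fin (j + 1) → Fin (3 * k)) t) :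
            MvPolynomial (Fin (3 * k) × Fin (3 * k)) R)) =
        (∏ t : Fin j,
          (X (finProdFinEquiv (b, Fin.castLE ((Nat.le_succ j).trans hj) t), g t) :
            MvPolynomial (Fin (3 * k) × Fin (3 * k)) R)) * X (finProdFinEquiv (b, ⟨j, hj⟩), x) := by
    intro g
    rw [Fin.prod_univ_castSucc]
    congr 1
    · refine Finset.prod_congr rfl fun t _ => ?_
      rw [Fin.snoc_castSucc]
      congr 3
    · rw [Fin.snoc_last]
      congr 3
  -- the conditions match
  have hcond : ∀ g : Fin j → Fin (3 * k),
      (Function.Injective (Fin.snoc g x : Fin (j + 1) → Fin (3 * k)) ∧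
        Finset.univ.image (Fin.snoc g x : Fin (j + 1) → Fin (3 * k)) = S) ↔
      (x ∈ S ∧ (Function.Injective g ∧ Finset.univ.image g = S.erase x)) := by
    intro g
    rw [snoc_injective_iff, image_univ_snoc]
    have hrange : x ∉ Set.range g ↔ x ∉ Finset.univ.image g := by simp [Finset.mem_image]
    rw [hrange]
    constructor
    · rintro ⟨⟨hg, hx⟩, hS⟩
      refine ⟨hS ▸ Finset.mem_insert_self _ _, hg, ?_⟩
      rw [← hS, Finset.erase_insert hx]
    · rintro ⟨hxS, hg, himg⟩
      refine ⟨⟨hg, ?_⟩, ?_⟩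
      · rw [himg]; exact Finset.notMem_erase x S
      · rw [himg, Finset.insert_erase hxS]
  simp_rw [hcond, hprod]
  split_ifs with hx
  · rw [Finset.sum_mul]
    refine Finset.sum_congr rfl fun g _ => ?_
    simp only [hx, true_and]
    split_ifs <;> simp
  · refine Finset.sum_eq_zero fun g _ => ?_
    simp [hx]

/-! ### The three-block Laplace expansion -/

/-- Three maps out of `Fin k` glue to an injective map out of `Fin 3 × Fin k` iff each is injective
and their images are pairwise disjoint. [folklore] -/
theorem injective_glue_three_iff {β : Type*} [DecidableEq β] {k : ℕ} (a b c : Fin k → β) :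
    Function.Injective (fun p : Fin 3 × Fin k => (![a, b, c] : Fin 3 → Fin k → β) p.1 p.2) ↔
      Function.Injective a ∧ Function.Injective b ∧ Function.Injective c ∧
        Disjoint (Finset.univ.image a) (Finset.univ.image b) ∧
        Disjoint (Finset.univ.image a) (Finset.univ.image c) ∧
        Disjoint (Finset.univ.image b) (Finset.univ.image c) := by
  constructor
  · intro h
    have hinj : ∀ i : Fin 3, Function.Injective ((![a, b, c] : Fin 3 → Fin k → β) i) :=
      fun i t t' htt' => by
        have := @h (i, t) (i, t') (by simpa using htt')
        simpa using this
    have hdis : ∀ i i' : Fin 3, i ≠ i' →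
        Disjoint (Finset.univ.image ((![a, b, c] : Fin 3 → Fin k → β) i))
          (Finset.univ.image ((![a, b, c] : Fin 3 → Fin k → β) i')) := by
      intro i i' hii'
      rw [Finset.disjoint_left]
      intro y hy hy'
      simp only [Finset.mem_image, Finset.mem_univ, true_and] at hy hy'
      obtain ⟨t, rfl⟩ := hy
      obtain ⟨t', ht'⟩ := hy'
      have := @h (i', t') (i, t) (by simpa using ht')
      exact hii' (congrArg Prod.fst this).symm
    exact ⟨hinj 0, hinj 1, hinj 2, hdis 0 1 (by decide), hdis 0 2 (by decide),
      hdis 1 2 (by decide)⟩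
  · rintro ⟨ha, hb, hc, hab, hac, hbc⟩ ⟨i, t⟩ ⟨i', t'⟩ h
    have key : ∀ {f g : Fin k → β}, Disjoint (Finset.univ.image f) (Finset.univ.image g) →
        ∀ t t', f t ≠ g t' := by
      intro f g hfg t t' hft
      exact Finset.disjoint_left.mp hfg (Finset.mem_image_of_mem f (Finset.mem_univ t))
        (hft ▸ Finset.mem_image_of_mem g (Finset.mem_univ t'))
    fin_cases i <;> fin_cases i' <;> simp at h
    · rw [ha h]
    · exact absurd h (key hab t t')
    · exact absurd h (key hac t t')
    · exact absurd h.symm (key hab t' t)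
    · rw [hb h]
    · exact absurd h (key hbc t t')
    · exact absurd h.symm (key hac t' t)
    · exact absurd h.symm (key hbc t' t)
    · rw [hc h]

/-- **The three-row-block Laplace expansion of `per_{3k}` as an evaluation of Pratt's tripartition
form** (route thesis; K. Pratt, arXiv:2311.02774 §1): substituting for `X (b, S)` the block
permanent `P_b(S) = ∑_{f : Fin k ↪ cols, im f = S} ∏_t X ((b,t), f t)` of row block `b` on the column
set `S` into `T_k = ∑_{S,T,U pairwise disjoint} X(0,S) X(1,T) X(2,U)` yields `perPoly (Fin (3k))`.
[folklore] -/
theorem aeval_tripartition_eq_perPoly (k : ℕ) :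
    MvPolynomial.aeval (R := R)
      (fun v : Fin 3 × {A : Finset (Fin (3 * k)) // A.card = k} =>
        ∑ f : Fin k → Fin (3 * k),
          (if Function.Injective f ∧ Finset.univ.image f = v.2.1 then
            ∏ t : Fin k, (X (finProdFinEquiv (v.1, t), f t) : MvPolynomial (Fin (3 * k) × Fin (3 * k)) R)
           else 0))
      (∑ S : {A : Finset (Fin (3 * k)) // A.card = k}, ∑ T : {A : Finset (Fin (3 * k)) // A.card = k},
        ∑ U : {A : Finset (Fin (3 * k)) // A.card = k},
          if Disjoint S.1 T.1 ∧ Disjoint S.1 U.1 ∧ Disjoint T.1 U.1 then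
            (X (0, S) * X (1, T) * X (2, U) :
              MvPolynomial (Fin 3 × {A : Finset (Fin (3 * k)) // A.card = k}) R)
          else 0) =
    perPoly (Fin (3 * k)) R := by
  classical
  -- abbreviations for the block monomials
  set P : Fin 3 → (Fin k → Fin (3 * k)) → MvPolynomial (Fin (3 * k) × Fin (3 * k)) R :=
    fun b f => ∏ t : Fin k, X (finProdFinEquiv (b, t), f t) with hP
  -- LEFT: push `aeval` through and collapse the subset sums
  have hL : MvPolynomial.aeval (R := R)
      (fun v : Fin 3 × {A : Finset (Fin (3 * k)) // A.card = k} =>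
        ∑ f : Fin k → Fin (3 * k),
          (if Function.Injective f ∧ Finset.univ.image f = v.2.1 then P v.1 f else 0))
      (∑ S : {A : Finset (Fin (3 * k)) // A.card = k}, ∑ T : {A : Finset (Fin (3 * k)) // A.card = k},
        ∑ U : {A : Finset (Fin (3 * k)) // A.card = k},
          if Disjoint S.1 T.1 ∧ Disjoint S.1 U.1 ∧ Disjoint T.1 U.1 then
            (X (0, S) * X (1, T) * X (2, U) :
              MvPolynomial (Fin 3 × {A : Finset (Fin (3 * k)) // A.card = k}) R)
          else 0) =
      ∑ a : Fin k → Fin (3 * k), ∑ b : Fin k → Fin (3 * k), ∑ c : Fin k → Fin (3 * k),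
        if Function.Injective a ∧ Function.Injective b ∧ Function.Injective c ∧
            Disjoint (Finset.univ.image a) (Finset.univ.image b) ∧
            Disjoint (Finset.univ.image a) (Finset.univ.image c) ∧
            Disjoint (Finset.univ.image b) (Finset.univ.image c) then
          P 0 a * P 1 b * P 2 c else 0 := by
    simp only [map_sum]
    -- each summand
    have hsummand : ∀ S T U : {A : Finset (Fin (3 * k)) // A.card = k},
        MvPolynomial.aeval (R := R)
          (fun v : Fin 3 × {A : Finset (Fin (3 * k)) // A.card = k} =>
            ∑ f : Fin k → Fin (3 * k),
              (if Function.Injective f ∧ Finset.univ.image f = v.2.1 then P v.1 f else 0))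
          (if Disjoint S.1 T.1 ∧ Disjoint S.1 U.1 ∧ Disjoint T.1 U.1 then
            (X (0, S) * X (1, T) * X (2, U) :
              MvPolynomial (Fin 3 × {A : Finset (Fin (3 * k)) // A.card = k}) R)
          else 0) =
        ∑ a : Fin k → Fin (3 * k), ∑ b : Fin k → Fin (3 * k), ∑ c : Fin k → Fin (3 * k),
          if (Function.Injective a ∧ Finset.univ.image a = S.1) ∧
              (Function.Injective b ∧ Finset.univ.image b = T.1) ∧
              (Function.Injective c ∧ Finset.univ.image c = U.1) ∧
              (Disjoint S.1 T.1 ∧ Disjoint S.1 U.1 ∧ Disjoint T.1 U.1) then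
            P 0 a * P 1 b * P 2 c else 0 := by
      intro S T U
      split_ifs with hd
      · simp only [map_mul, MvPolynomial.aeval_X]
        rw [Finset.sum_mul, Finset.sum_mul]
        refine Finset.sum_congr rfl fun a _ => ?_
        rw [mul_assoc, Finset.sum_mul, Finset.mul_sum]
        refine Finset.sum_congr rfl fun b _ => ?_
        rw [Finset.mul_sum, Finset.mul_sum]
        refine Finset.sum_congr rfl fun c _ => ?_
        by_cases ca : (Function.Injective a ∧ Finset.univ.image a = S.1) <;>
          by_cases cb : (Function.Injective b ∧ Finset.univ.image b = T.1) <;>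
            by_cases cc : (Function.Injective c ∧ Finset.univ.image c = U.1) <;>
              simp [ca, cb, cc, hd, mul_assoc]
      · simp only [map_zero]
        symm
        refine Finset.sum_eq_zero fun a _ => Finset.sum_eq_zero fun b _ =>
          Finset.sum_eq_zero fun c _ => ?_
        rw [if_neg]
        rintro ⟨-, -, -, h⟩
        exact hd h
    simp_rw [hsummand]
    -- swap the subset sums with the map sums
    have hswap : ∀ F : {A : Finset (Fin (3 * k)) // A.card = k} → {A : Finset (Fin (3 * k)) // A.card = k} →
        {A : Finset (Fin (3 * k)) // A.card = k} → (Fin k → Fin (3 * k)) → (Fin k → Fin (3 * k)) →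
        (Fin k → Fin (3 * k)) → MvPolynomial (Fin (3 * k) × Fin (3 * k)) R,
        (∑ S, ∑ T, ∑ U, ∑ a, ∑ b, ∑ c, F S T U a b c) = ∑ a, ∑ b, ∑ c, ∑ S, ∑ T, ∑ U, F S T U a b c := by
      intro F
      calc (∑ S, ∑ T, ∑ U, ∑ a, ∑ b, ∑ c, F S T U a b c)
          = ∑ p : {A : Finset (Fin (3 * k)) // A.card = k} × {A : Finset (Fin (3 * k)) // A.card = k} ×
              {A : Finset (Fin (3 * k)) // A.card = k},
              ∑ q : (Fin k → Fin (3 * k)) × (Fin k → Fin (3 * k)) × (Fin k → Fin (3 * k)),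
                F p.1 p.2.1 p.2.2 q.1 q.2.1 q.2.2 := by
            simp only [Fintype.sum_prod_type]
        _ = ∑ q : (Fin k → Fin (3 * k)) × (Fin k → Fin (3 * k)) × (Fin k → Fin (3 * k)),
              ∑ p : {A : Finset (Fin (3 * k)) // A.card = k} × {A : Finset (Fin (3 * k)) // A.card = k} ×
                {A : Finset (Fin (3 * k)) // A.card = k},
                F p.1 p.2.1 p.2.2 q.1 q.2.1 q.2.2 := Finset.sum_comm
        _ = _ := by simp only [Fintype.sum_prod_type]
    rw [hswap]
    refine Finset.sum_congr rfl fun a _ => Finset.sum_congr rfl fun b _ =>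
      Finset.sum_congr rfl fun c _ => ?_
    -- collapse the three subset sums
    by_cases ha : Function.Injective a
    swap
    · simp [ha]
    by_cases hb : Function.Injective b
    swap
    · simp [hb]
    by_cases hc : Function.Injective c
    swap
    · simp [hc]
    have hcard : ∀ {f : Fin k → Fin (3 * k)}, Function.Injective f → (Finset.univ.image f).card = k :=
      fun hf => by rw [Finset.card_image_of_injective _ hf, Finset.card_univ, Fintype.card_fin]
    rw [Fintype.sum_eq_single (⟨Finset.univ.image a, hcard ha⟩ : {A : Finset (Fin (3 * k)) // A.card = k})]
    · rw [Fintype.sum_eq_single (⟨Finset.univ.image b, hcard hb⟩ : {A : Finset (Fin (3 * k)) // A.card = k})]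
      · rw [Fintype.sum_eq_single (⟨Finset.univ.image c, hcard hc⟩ : {A : Finset (Fin (3 * k)) // A.card = k})]
        · simp [ha, hb, hc]
        · intro U hU
          have hne : Finset.univ.image c ≠ U.1 := fun h => hU (Subtype.ext h).symm
          simp [hne]
      · intro T hT
        have hne : Finset.univ.image b ≠ T.1 := fun h => hT (Subtype.ext h).symm
        simp [hne]
    · intro S hS
      have hne : Finset.univ.image a ≠ S.1 := fun h => hS (Subtype.ext h).symm
      simp [hne]
  -- RIGHT: the permanent as a sum over triples of injective block maps with disjoint images
  have hR : perPoly (Fin (3 * k)) R =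
      ∑ a : Fin k → Fin (3 * k), ∑ b : Fin k → Fin (3 * k), ∑ c : Fin k → Fin (3 * k),
        if Function.Injective a ∧ Function.Injective b ∧ Function.Injective c ∧
            Disjoint (Finset.univ.image a) (Finset.univ.image b) ∧
            Disjoint (Finset.univ.image a) (Finset.univ.image c) ∧
            Disjoint (Finset.univ.image b) (Finset.univ.image c) then
          P 0 a * P 1 b * P 2 c else 0 := by
    rw [perPoly_eq_sum_filter_bijective R, Finset.sum_filter]
    -- reindex the rows by `Fin 3 × Fin k`
    have h1 : (∑ j : Fin (3 * k) → Fin (3 * k), if Function.Bijective j then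
          ∏ i, (X (i, j i) : MvPolynomial (Fin (3 * k) × Fin (3 * k)) R) else 0) =
        ∑ g : Fin 3 × Fin k → Fin (3 * k), if Function.Injective g then
          ∏ p, (X (finProdFinEquiv p, g p) : MvPolynomial (Fin (3 * k) × Fin (3 * k)) R) else 0 := by
      refine (Fintype.sum_equiv ((finProdFinEquiv (m := 3) (n := k)).arrowCongr (Equiv.refl _))
        _ _ fun g => ?_).symm
      have hg : ((finProdFinEquiv (m := 3) (n := k)).arrowCongr (Equiv.refl (Fin (3 * k)))) g =
          g ∘ finProdFinEquiv.symm := by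
        ext i; simp [Equiv.arrowCongr_apply]
      have hbij : Function.Bijective (g ∘ (finProdFinEquiv (m := 3) (n := k)).symm) ↔
          Function.Injective g := by
        rw [Function.Bijective.of_comp_iff g finProdFinEquiv.symm.bijective,
          Fintype.bijective_iff_injective_and_card]
        simp
      have hprod : (∏ p, (X (finProdFinEquiv p, g p) : MvPolynomial (Fin (3 * k) × Fin (3 * k)) R)) =
          ∏ i, (X (i, (g ∘ finProdFinEquiv.symm) i) : MvPolynomial (Fin (3 * k) × Fin (3 * k)) R) :=
        Fintype.prod_equiv finProdFinEquiv _ _ (fun p => by simp)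
      rw [hg]
      simp only [hbij, hprod]
    rw [h1]
    -- split `g` into its three block maps
    let E : ((Fin k → Fin (3 * k)) × (Fin k → Fin (3 * k)) × (Fin k → Fin (3 * k))) ≃
        (Fin 3 × Fin k → Fin (3 * k)) :=
      { toFun := fun q p => (![q.1, q.2.1, q.2.2] : Fin 3 → Fin k → Fin (3 * k)) p.1 p.2
        invFun := fun g => (fun t => g (0, t), fun t => g (1, t), fun t => g (2, t))
        left_inv := fun q => by
          obtain ⟨a, b, c⟩ := q
          simp
        right_inv := fun g => by
          funext p
          obtain ⟨i, t⟩ := p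
          fin_cases i <;> simp }
    rw [← Fintype.sum_equiv E (fun q => if Function.Injective (E q) then
        ∏ p, (X (finProdFinEquiv p, E q p) : MvPolynomial (Fin (3 * k) × Fin (3 * k)) R) else 0) _
      (fun q => rfl)]
    rw [Fintype.sum_prod_type]
    refine Finset.sum_congr rfl fun a _ => ?_
    rw [Fintype.sum_prod_type]
    refine Finset.sum_congr rfl fun b _ => Finset.sum_congr rfl fun c _ => ?_
    change (if Function.Injective
        (fun p : Fin 3 × Fin k => (![a, b, c] : Fin 3 → Fin k → Fin (3 * k)) p.1 p.2) then
        ∏ p : Fin 3 × Fin k, (X (finProdFinEquiv p,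
          (![a, b, c] : Fin 3 → Fin k → Fin (3 * k)) p.1 p.2) : MvPolynomial (Fin (3 * k) × Fin (3 * k)) R)
        else 0) = _
    simp only [injective_glue_three_iff]
    congr 1
    rw [Fintype.prod_prod_type]
    simp only [Fin.prod_univ_three, Matrix.cons_val_zero, Matrix.cons_val_one,
      Matrix.cons_val_two, Matrix.head_cons, Matrix.tail_cons, hP]
  rw [hR]
  simpa only [hP] using hL

end Summit.ValiantsHypothesis.ValiantsHypothesis.Theorems.RyserTripartition
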